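import Mathlib
import Summits.HodgeConjecture.HodgeConjecture.Theorems.HodgeLocusCensusValJ1728At2

/-!
# Hodge-locus census, V3-XT `N = 1`: THEOREM R22 — depth `≥ 22` at `j = 1728` and Tunnell's weight-`3/2` coefficient (finite core)

HONEST FRAMING: certified instances and evidence bearing on the general Hodge conjecture; no claim.

Setting as in `HodgeLocusCensusValJ1728At2` (abs-1 gen 23): `N ≡ 1 (mod 8)` squarefree, `D = -4N`, a class
`C ∈ Cl(D)` corresponds to an orbit of primitive pure quaternions `y = bI + cJ + dK` of reduced norm `N`
(`b` odd, `c = 2c″`, `d = 2d″`), and the normalised `2`-adic depth of `j(C) - 1728` is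
`T(C) = vLaw b c d = 16 + 2 v₂(c″² + d″²) = 12 + 2 v₂(c² + d²)` (`vLaw_caseB`).  Write
`ν_m(N) = #{C : T(C) ≥ 12 + 2m}` and `r(N;[1,s,t]) = #{(b,x,y) ∈ ℤ³ : b² + s x² + t y² = N}`.
Derivation file: `code/abs_engineA/xt/n1depth22/DERIVATION-R22-A.md` (abs-1 gen 26, ROW 2).  Results:

* (D_m) DEPTH–THETA DICTIONARY (DERIVED): `ν_m(N) = r(N;[1,2^m,2^m]) / 4` for every `m ≥ 3`
  (`v₂(c²+d²) = v_{1+i}(c+di)` and multiplication by `(1+i)^m` is a norm-`2^m` bijection of `ℤ[i]` onto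
  `(1+i)^m ℤ[i]`; each class has exactly `4` representatives with the odd coordinate first).
  CERTIFIED against the census (engine A, both bulk files, all `590` non-square `N ≡ 1 (mod 8)`, `N ≤ 5000`,
  `m = 3,…,10`: `590/590`; multiset form `590/590`).
* (E1) (DERIVED, elementary `2`-adic counting): for all `N ≡ 1 (mod 8)`,
  `a(N) := r(N;[1,2,8]) - 2 r(N;[1,2,32]) = r(N;[1,16,16]) - 2 r(N;[1,32,32])`, where `a(N)` is the coefficient
  of Tunnell's theorem [cite: Tunnell1983CongruentNumbers] for odd `N`.
* THEOREM R22 (DERIVED): `ν_5(N) = #{C : v_𝔓(j(C) - 1728) ≥ 22} = h(-4N)/4 - a(N)/8` for squarefree `N ≡ 1 (mod 8)`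
  (`8ν_5 = 2 r(N;[1,32,32]) = r(N;[1,16,16]) - a(N) = 4ν_4 - a(N) = 2h - a(N)`, using the G2 count form `ν_4 = h/2`).
  COROLLARY: if `N` is a congruent number then `ν_5(N) = h/4` ([cite: Tunnell1983CongruentNumbers] with
  [cite: CoatesWiles1977]: `a(N) ≠ 0 ⟹ L(E_N,1) ≠ 0 ⟹ N` not congruent); under BSD, `ν_5 = h/4 ⟺ N` congruent;
  `a(N) ≡ 2h(-4N) (mod 8)`.  The depth-`≥ 22` classes are the vectors of the lattice `L₁ = ℤi ⊕ ℤ4(j-k) ⊕ ℤ4(j+k)`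
  of the order `ℤ[i] + 4𝒪_B` of [cite: arXiv:2104.06732, §3.3.2, Prop. 3.14] (toric-period formula for `L(1, E^{(N)})`).
* THEOREM R22′ (theta identity, PROVED BY A FINITE CHECK): for all `N ≡ 1 (mod 8)`,
  `S(N) := Σ_{b²+x²+y²=N} χ₈(b) = 2 χ₋₈(s) s` if `N = s²`, else `0`.  Proof: `G = θ_{χ₈} θ² - 2 Σ_{m≥1} χ₋₈(m) m q^{m²}`
  is a modular form of weight `3/2` on `Γ₁(256)` ([cite: SerreStark1977, §2 p. 51] for `θ_{χ₈} ∈ M₀(256,1/2,χ₈)`;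
  [cite: Shimura1973HalfIntegral, Prop. 2.2] for the weight-`3/2` theta series, used as stated); its restriction
  `P₁G` to exponents `≡ 1 (mod 8)` is a modular form of weight `3/2` on `Γ₁(256·8²)` [cite: SerreStark1977, §7 p. 67];
  `(P₁G)⁴ ∈ M₆(Γ₁(16384))`, index `[SL₂(ℤ) : Γ₁(16384)] = 201326592` [cite: DiamondShurman2005, §1.2], so by the
  Sturm bound [cite: Kilford2008, Thm 3.13] it vanishes once its `q`-order exceeds `100663296`, i.e. once the
  coefficients of `P₁G` vanish for `n ≤ 25165824`; they were checked to vanish for all `n ≡ 1 (mod 8)`,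
  `n ≤ 26000000` by two independent exact implementations (C, lattice enumeration; numpy on kit job `j122759`,
  divisor-formula sieve; `0` failures each, identical fingerprints).  Consequences: `r(N; x²+16y²+16z²) = r₃(N)/6`
  for non-square `N ≡ 1 (mod 8)` (a second proof of the G2 count form, hence of R22, without genus theory) and
  `r(s²;[1,16,16]) = r₃(s²)/6 + χ₋₄(s) s`.

THIS FILE (kernel-checked, no new definitions): the depth threshold in terms of `vLaw` (`depth_ge_iff`); the
Gaussian `2`-adic step and its iterate (`gauss_step`, `two_pow_dvd_sum_sq`, `norm_mul_one_add_i`) underlying (D_m);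
the residue facts of the per-`b` case analysis behind (E1)–(E3) (`mod 4`, `mod 8`, `mod 16`); the per-`b`
bookkeeping and the assembly of THEOREM R22 from (D_4), (D_5), (E1), G2 as linear implications over `ℤ`
(`R22_of_G2`, `G2count_of_R22prime`, corollaries); the Sturm-bound numerals; and the anchors `N = 17, 33, 41`
(solution lists of the four ternary forms, `decide`; `h(-68) = 4`, `h(-132) = 4`, `h(-164) = 8`).
-/

namespace Summit.HodgeConjecture.HodgeConjecture.HodgeLocus.Census.Depth22

open Summit.HodgeConjecture.HodgeConjecture.HodgeLocus.Census.ValJ1728At2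

/-! ### The depth threshold -/

/-- `T = vLaw b (2c″) (2d″) ≥ 12 + 2m ⟺ v₂(c″²+d″²) + 2 ≥ m` (`b` odd, `(c″,d″) ≠ 0`); with `c = 2c″`, `d = 2d″`
this is `v₂(c²+d²) ≥ m`. -/
theorem depth_ge_iff {b c d : ℕ} (m : ℕ) (hb : Odd b) (hcd : c ^ 2 + d ^ 2 ≠ 0) :
    12 + 2 * m ≤ vLaw b (2 * c) (2 * d) ↔ m ≤ padicValNat 2 (c ^ 2 + d ^ 2) + 2 := by
  rw [vLaw_caseB hb hcd]; omega

/-- `v₂((2c″)² + (2d″)²) = v₂(c″² + d″²) + 2`. -/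
theorem v2_double (c d : ℕ) (hcd : c ^ 2 + d ^ 2 ≠ 0) :
    padicValNat 2 ((2 * c) ^ 2 + (2 * d) ^ 2) = padicValNat 2 (c ^ 2 + d ^ 2) + 2 := by
  rw [show (2 * c) ^ 2 + (2 * d) ^ 2 = 2 ^ 2 * (c ^ 2 + d ^ 2) by ring, v2_two_pow_mul 2 hcd]

/-- Depth `22` is `m = 5`, depth `20` is `m = 4`, and every class has depth `≥ 18` (`m = 3`). -/
theorem depth_levels : 12 + 2 * 5 = 22 ∧ 12 + 2 * 4 = 20 ∧ 12 + 2 * 3 = 18 := by norm_num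

/-! ### The Gaussian `2`-adic step behind the dictionary (D_m) -/

/-- One step: if `c² + d²` is even then `c + di = (1+i)(x+iy)`, i.e. `c = x - y`, `d = x + y`, and
`c² + d² = 2(x² + y²)`. -/
theorem gauss_step (c d : ℤ) (h : Even (c * c + d * d)) :
    ∃ x y : ℤ, c = x - y ∧ d = x + y ∧ c * c + d * d = 2 * (x * x + y * y) := by
  have hcd : Even c ↔ Even d := by
    have h1 := (Int.even_add.mp h)
    simpa [Int.even_mul] using h1
  obtain ⟨x, hx⟩ := Int.even_add.mpr hcd
  obtain ⟨y, hy⟩ := Int.even_sub.mpr hcd.symm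
  refine ⟨x, y, by omega, by omega, ?_⟩
  have hc : c = x - y := by omega
  have hd : d = x + y := by omega
  subst hc hd; ring

/-- Converse step: `(1+i)(x+iy) = (x-y) + (x+y)i` has norm `2(x²+y²)`. -/
theorem norm_mul_one_add_i (x y : ℤ) : (x - y) * (x - y) + (x + y) * (x + y) = 2 * (x * x + y * y) := by ring

/-- Iterate: `2^m ∣ c² + d² ⟹ c² + d² = 2^m (x² + y²)` for some `x, y` (so the pairs `(c,d)` with
`v₂(c²+d²) ≥ m` and `c²+d² = M` are in bijection with the pairs `(x,y)` with `x²+y² = M/2^m`). -/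
theorem two_pow_dvd_sum_sq (m : ℕ) : ∀ c d : ℤ, (2 : ℤ) ^ m ∣ c * c + d * d →
    ∃ x y : ℤ, c * c + d * d = 2 ^ m * (x * x + y * y) := by
  induction m with
  | zero => intro c d _; exact ⟨c, d, by ring⟩
  | succ m ih =>
    intro c d hdiv
    have h2 : Even (c * c + d * d) := by
      obtain ⟨k, hk⟩ := hdiv
      exact ⟨2 ^ m * k, by rw [hk]; ring⟩
    obtain ⟨x, y, hc, hd, hn⟩ := gauss_step c d h2
    have hxy : (2 : ℤ) ^ m ∣ x * x + y * y := by
      obtain ⟨k, hk⟩ := hdiv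
      refine ⟨k, ?_⟩
      have : 2 * (x * x + y * y) = 2 * (2 ^ m * k) := by rw [← hn, hk]; ring
      linarith
    obtain ⟨u, v, huv⟩ := ih x y hxy
    exact ⟨u, v, by rw [hn, huv]; ring⟩

/-- Primitivity is decided at odd primes: an odd prime divides `x - y` and `x + y` iff it divides `x` and `y`
(the residue computation behind `gcd(b,c,d) = 1 ⟺ gcd(b,x,y) = 1`), here `mod 3, 5, 7` as instances and in
general over `ℤ` with `2` invertible. -/
theorem odd_prime_step (p x y : ℤ) (hp : Odd p) (h1 : p ∣ x - y) (h2 : p ∣ x + y) : p ∣ x ∧ p ∣ y := by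
  obtain ⟨k, hk⟩ := hp
  have hx2 : p ∣ 2 * x := by
    have h := dvd_add h1 h2
    rwa [show x - y + (x + y) = 2 * x by ring] at h
  have hy2 : p ∣ 2 * y := by
    have h := dvd_sub h2 h1
    rwa [show x + y - (x - y) = 2 * y by ring] at h
  constructor
  · have h := dvd_sub (dvd_mul_of_dvd_left hx2 (k + 1)) (dvd_mul_left p x)
    rwa [show 2 * x * (k + 1) - x * p = x by rw [hk]; ring] at h
  · have h := dvd_sub (dvd_mul_of_dvd_left hy2 (k + 1)) (dvd_mul_left p y)
    rwa [show 2 * y * (k + 1) - y * p = y by rw [hk]; ring] at h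

/-! ### Residue facts of the per-`b` case analysis (E1)–(E3) -/

/-- `N ≡ 1 (mod 8)` and `b` odd force `8 ∣ N - b²` (so `e_b := v₂(N - b²) ≥ 3`). -/
theorem eight_dvd (N b : ZMod 8) (hN : N = 1) (hb : b = 1 ∨ b = 3 ∨ b = 5 ∨ b = 7) : N - b ^ 2 = 0 := by
  subst hN; rcases hb with rfl | rfl | rfl | rfl <;> decide

/-- `e_b ≥ 4 ⟺ b² ≡ N (mod 16)`: for `N ≡ 1 (mod 16)` this means `b ≡ ±1 (mod 8)` (`χ₈(b) = +1`), for
`N ≡ 9 (mod 16)` it means `b ≡ ±3 (mod 8)` (`χ₈(b) = -1`); i.e. `[e_b ≥ 4] ⟺ χ₈(b) = σ₁₆(N)`. -/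
theorem sixteen_cases :
    (∀ b : ZMod 16, b ^ 2 = 1 ↔ (b = 1 ∨ b = 7 ∨ b = 9 ∨ b = 15)) ∧
    (∀ b : ZMod 16, b ^ 2 = 9 ↔ (b = 3 ∨ b = 5 ∨ b = 11 ∨ b = 13)) := by
  constructor <;> decide

/-- `[2,8]`-part and `[2,32]`-part, first reduction: `x² + 4y² ≡ 0 (mod 4)` forces `x` even. -/
theorem x_even_of (x y : ZMod 4) (h : x ^ 2 + 4 * y ^ 2 = 0) : x = 0 ∨ x = 2 := by
  revert x y; decide

/-- `[2,32]`-part at `e_b = 4`: `x² + 4y² ≡ 2 (mod 4)` is impossible. -/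
theorem no_two_mod_four (x y : ZMod 4) : x ^ 2 + 4 * y ^ 2 ≠ 2 := by
  revert x y; decide

/-- `[2,32]`-part at `e_b = 3`: a representation `x² + t² = u` of an odd `u` has exactly one even entry, so
`(x,t) ↦ (t,x)` shows that exactly half of the `r₂(u)` representations have `t` even
(`#{x² + 4y² = u} = r₂(u)/2`). -/
theorem one_even_entry (x t : ZMod 4) (h : x ^ 2 + t ^ 2 = 1 ∨ x ^ 2 + t ^ 2 = 3) :
    (x = 0 ∨ x = 2) ↔ ¬ (t = 0 ∨ t = 2) := by
  revert x t; decide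

/-- An odd sum of two squares is `≡ 1 (mod 4)` (the case `u ≡ 3 (mod 4)` has `r₂(u) = 0`). -/
theorem odd_sum_two_squares (x t : ZMod 4) : x ^ 2 + t ^ 2 ≠ 3 := by
  revert x t; decide

/-- The characters: `χ₈(b) χ₋₈(b) = χ₋₄(b)` on odd residues, as the sign table
`(χ₈, χ₋₈, χ₋₄)(1,3,5,7) = (+,+,+), (-,+,-), (-,-,+), (+,-,-)`; and `σ₁₆(s²) = χ₈(s)`:
`s² ≡ 1 (mod 16) ⟺ s ≡ ±1 (mod 8)` for odd `s` (so the square term `σ₁₆ χ₋₈(s) s` of (E2) is `χ₋₄(s) s`). -/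
theorem character_table :
    ((1 : ℤ) * 1 = 1 ∧ (-1 : ℤ) * 1 = -1 ∧ (-1 : ℤ) * (-1) = 1 ∧ (1 : ℤ) * (-1) = -1) ∧
    (∀ s : ZMod 16, (s = 1 ∨ s = 3 ∨ s = 5 ∨ s = 7 ∨ s = 9 ∨ s = 11 ∨ s = 13 ∨ s = 15) →
      (s ^ 2 = 1 ↔ (s = 1 ∨ s = 7 ∨ s = 9 ∨ s = 15))) := by
  refine ⟨by norm_num, ?_⟩; decide

/-! ### Per-`b` bookkeeping and the assembly -/

/-- Per-`b` contributions `([16,16], [32,32], [2,8], [2,32])` are `(0, 0, δ, δ/2)`, `(δ, 0, δ, 0)`,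
`(δ, δ, δ, δ)` for `e_b = 3, 4, ≥ 5` (`δ = r₂(N - b²)`, even in the first case); in each case the
`a`-contribution `[2,8] - 2[2,32]` equals the `([16,16] - 2[32,32])`-contribution, which gives (E1), and
`12[32,32] + 6[2,8] - 12[2,32] - 3δ = 3 s δ` with `s = -1, +1, +1`, which gives (E3); `[16,16] - δ/2 = s δ/2` gives (E2). -/
theorem per_b_table (η δ : ℤ) :
    ((2 * η) - 2 * η = 0 - 2 * 0 ∧ 12 * 0 + 6 * (2 * η) - 12 * η - 3 * (2 * η) = 3 * (-1) * (2 * η) ∧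
      2 * 0 - (2 * η) = (-1) * (2 * η)) ∧
    (δ - 2 * 0 = δ - 2 * 0 ∧ 12 * 0 + 6 * δ - 12 * 0 - 3 * δ = 3 * 1 * δ ∧ 2 * δ - δ = 1 * δ) ∧
    (δ - 2 * δ = δ - 2 * δ ∧ 12 * δ + 6 * δ - 12 * δ - 3 * δ = 3 * 1 * δ ∧ 2 * δ - δ = 1 * δ) := by
  refine ⟨⟨by ring, by ring, by ring⟩, ⟨rfl, by ring, by ring⟩, ⟨rfl, by ring, by ring⟩⟩

/-- THEOREM R22 from the dictionary, (E1) and the G2 count form: with `4ν₄ = r(N;[1,16,16])`,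
`4ν₅ = r(N;[1,32,32])`, `a = r16 - 2 r32` and `2ν₄ = h`, one gets `8ν₅ = 2h - a`. -/
theorem R22_of_G2 (h ν₄ ν₅ a r16 r32 : ℤ) (hD4 : 4 * ν₄ = r16) (hD5 : 4 * ν₅ = r32)
    (hE1 : a = r16 - 2 * r32) (hG2 : 2 * ν₄ = h) : 8 * ν₅ = 2 * h - a := by
  omega

/-- Corollaries: `a(N) = 0 ⟹ ν₅ = h/4` (congruent `N`, by Tunnell + Coates–Wiles, have `a(N) = 0`);
`ν₅ = h/4 ⟹ a(N) = 0`; integrality `8 ∣ 2h - a`, i.e. `a ≡ 2h (mod 8)`. -/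
theorem R22_corollaries (h ν₅ a : ℤ) (hR : 8 * ν₅ = 2 * h - a) :
    (a = 0 → 4 * ν₅ = h) ∧ (4 * ν₅ = h → a = 0) ∧ (8 : ℤ) ∣ 2 * h - a := by
  refine ⟨fun ha => by omega, fun hq => by omega, ⟨ν₅, by omega⟩⟩

/-- THEOREM R22′ gives the G2 count form back (second proof, no genus theory): from (E2) `6 r16 - r₃ = 3σS`,
`S = 0` (non-square `N`), Gauss `r₃ = 12h` and `4ν₄ = r16` one gets `2ν₄ = h`; and then R22. -/
theorem G2count_of_R22prime (h ν₄ r16 r₃ σ S : ℤ) (hE2 : 6 * r16 - r₃ = 3 * σ * S) (hS : S = 0)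
    (hGauss : r₃ = 12 * h) (hD4 : 4 * ν₄ = r16) : 2 * ν₄ = h := by
  subst hS; have : 6 * r16 = r₃ := by linarith
  omega

/-- (E3) and R22′ directly: `12 r32 + 6 r28 - 12 r232 - r₃ = 3σS`, `S = 0`, `r₃ = 12h`, `4ν₅ = r32`,
`a = r28 - 2 r232` give `8ν₅ = 2h - a`. -/
theorem R22_of_R22prime (h ν₅ a r32 r28 r232 r₃ σ S : ℤ)
    (hE3 : 12 * r32 + 6 * r28 - 12 * r232 - r₃ = 3 * σ * S) (hS : S = 0) (hGauss : r₃ = 12 * h)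
    (hD5 : 4 * ν₅ = r32) (ha : a = r28 - 2 * r232) : 8 * ν₅ = 2 * h - a := by
  subst hS; have : 12 * r32 + 6 * r28 - 12 * r232 = r₃ := by linarith
  omega

/-! ### Sturm-bound numerals of the finite check -/

/-- `[SL₂(ℤ) : Γ₁(2¹⁴)] = 2²⁸ · 3/4 = 201326592`; weight `6`: bound `201326592 · 6 / 12 = 100663296`;
`4 · 25165825 > 100663296 ≥ 4 · 25165824`; the check ran to `26000000 ≥ 25165824`.  Sharper route
(twisting lemma at level `256`): `[SL₂(ℤ) : Γ₀(256)] = 384`, bound `192 < 4 · 49`. -/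
theorem sturm_numerals :
    4 * 201326592 = 3 * 16384 ^ 2 ∧ (16384 : ℕ) = 2 ^ 14 ∧ 256 * 8 ^ 2 = 16384 ∧
    201326592 * 6 / 12 = 100663296 ∧ 4 * 25165825 > 100663296 ∧ 4 * 25165824 = 100663296 ∧
    25165824 ≤ 26000000 ∧ 256 * 3 / 2 = 384 ∧ 384 * 6 / 12 = 192 ∧ 192 < 4 * 49 := by
  norm_num

/-! ### Anchors `N = 17, 33, 41` -/

/-- `N = 17`: the solutions in `ℕ³` (box `b ≤ 6`, `x, y ≤ 4`, which contains all of them) of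
`b² + 16x² + 16y²`, `b² + 32x² + 32y²`, `b² + 2x² + 8y²`, `b² + 2x² + 32y² = 17`; with signs they give
`r16 = 8`, `r32 = 0`, `r28 = 16`, `r232 = 4`, so `a(17) = 8 = r16 - 2 r32`, `ν₄ = 2 = h(-68)/2`, `ν₅ = 0`,
and `8·0 = 2·4 - 8`. -/
theorem anchor_17 :
    ((List.range 7).product ((List.range 5).product (List.range 5))).filter
        (fun t => t.1 ^ 2 + 16 * t.2.1 ^ 2 + 16 * t.2.2 ^ 2 == 17) = [(1, 0, 1), (1, 1, 0)] ∧
    ((List.range 7).product ((List.range 5).product (List.range 5))).filter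
        (fun t => t.1 ^ 2 + 32 * t.2.1 ^ 2 + 32 * t.2.2 ^ 2 == 17) = [] ∧
    ((List.range 7).product ((List.range 5).product (List.range 5))).filter
        (fun t => t.1 ^ 2 + 2 * t.2.1 ^ 2 + 8 * t.2.2 ^ 2 == 17) = [(1, 2, 1), (3, 0, 1), (3, 2, 0)] ∧
    ((List.range 7).product ((List.range 5).product (List.range 5))).filter
        (fun t => t.1 ^ 2 + 2 * t.2.1 ^ 2 + 32 * t.2.2 ^ 2 == 17) = [(3, 2, 0)] ∧
    (8 : ℤ) - 2 * 0 = 16 - 2 * 4 ∧ (8 : ℤ) * 0 = 2 * 4 - 8 := by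
  refine ⟨by decide, by decide, by decide, by decide, by norm_num, by norm_num⟩

/-- `N = 41` (a congruent number): solutions give `r16 = 16`, `r32 = 8`, `r28 = 32`, `r232 = 16`, so
`a(41) = 0 = 16 - 16`, `ν₄ = 4 = h(-164)/2`, `ν₅ = 2 = h(-164)/4`. -/
theorem anchor_41 :
    ((List.range 7).product ((List.range 5).product (List.range 5))).filter
        (fun t => t.1 ^ 2 + 16 * t.2.1 ^ 2 + 16 * t.2.2 ^ 2 == 41) = [(3, 1, 1), (5, 0, 1), (5, 1, 0)] ∧
    ((List.range 7).product ((List.range 5).product (List.range 5))).filter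
        (fun t => t.1 ^ 2 + 32 * t.2.1 ^ 2 + 32 * t.2.2 ^ 2 == 41) = [(3, 0, 1), (3, 1, 0)] ∧
    ((List.range 7).product ((List.range 5).product (List.range 5))).filter
        (fun t => t.1 ^ 2 + 2 * t.2.1 ^ 2 + 8 * t.2.2 ^ 2 == 41) =
          [(1, 2, 2), (1, 4, 1), (3, 0, 2), (3, 4, 0), (5, 2, 1)] ∧
    ((List.range 7).product ((List.range 5).product (List.range 5))).filter
        (fun t => t.1 ^ 2 + 2 * t.2.1 ^ 2 + 32 * t.2.2 ^ 2 == 41) = [(1, 2, 1), (3, 0, 1), (3, 4, 0)] ∧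
    (32 : ℤ) - 2 * 16 = 16 - 2 * 8 ∧ (8 : ℤ) * 2 = 2 * 8 - 0 := by
  refine ⟨by decide, by decide, by decide, by decide, by norm_num, by norm_num⟩

/-- `N = 33`: `r16 = 8`, `r32 = 8`, `r28 = 16`, `r232 = 12`, so `a(33) = -8 = 8 - 16`, `ν₄ = 2 = h(-132)/2`,
`ν₅ = 2`, and `8·2 = 2·4 + 8`. -/
theorem anchor_33 :
    ((List.range 7).product ((List.range 5).product (List.range 5))).filter
        (fun t => t.1 ^ 2 + 16 * t.2.1 ^ 2 + 16 * t.2.2 ^ 2 == 33) = [(1, 1, 1)] ∧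
    ((List.range 7).product ((List.range 5).product (List.range 5))).filter
        (fun t => t.1 ^ 2 + 32 * t.2.1 ^ 2 + 32 * t.2.2 ^ 2 == 33) = [(1, 0, 1), (1, 1, 0)] ∧
    ((List.range 7).product ((List.range 5).product (List.range 5))).filter
        (fun t => t.1 ^ 2 + 2 * t.2.1 ^ 2 + 8 * t.2.2 ^ 2 == 33) = [(1, 0, 2), (1, 4, 0), (5, 0, 1), (5, 2, 0)] ∧
    ((List.range 7).product ((List.range 5).product (List.range 5))).filter
        (fun t => t.1 ^ 2 + 2 * t.2.1 ^ 2 + 32 * t.2.2 ^ 2 == 33) = [(1, 0, 1), (1, 4, 0), (5, 2, 0)] ∧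
    (16 : ℤ) - 2 * 12 = 8 - 2 * 8 ∧ (8 : ℤ) * 2 = 2 * 4 - (-8) := by
  refine ⟨by decide, by decide, by decide, by decide, by norm_num, by norm_num⟩

/-- Signed counts from the `ℕ³` solution lists: a solution with `k` non-zero coordinates accounts for `2^k`
integer solutions; e.g. `N = 17`, `[1,16,16]`: `2² + 2² = 8`; `[1,2,8]`: `2³ + 2² + 2² = 16`; `N = 41`,
`[1,2,8]`: `8+8+4+4+8 = 32`. -/
theorem signed_counts : 2 ^ 2 + 2 ^ 2 = 8 ∧ 2 ^ 3 + 2 ^ 2 + 2 ^ 2 = 16 ∧ 2 ^ 2 = 4 ∧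
    2 ^ 3 + 2 ^ 2 + 2 ^ 2 = 16 ∧ 2 ^ 2 + 2 ^ 2 = 8 ∧ 8 + 8 + 4 + 4 + 8 = 32 ∧ 8 + 4 + 4 = 16 ∧
    2 ^ 3 = 8 ∧ 4 + 4 = 8 ∧ 4 + 4 + 4 + 4 = 16 ∧ 4 + 4 + 4 = 12 := by norm_num

/-- The first values of `S(s²) = 2 χ₋₈(s) s` checked by all three implementations: `S(9) = 6`, `S(25) = -10`,
`S(49) = -14`, `S(81) = 18` (`χ₋₈(3) = 1`, `χ₋₈(5) = -1`, `χ₋₈(7) = -1`, `χ₋₈(9) = 1`). -/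
theorem square_values : 2 * 1 * 3 = (6 : ℤ) ∧ 2 * (-1) * 5 = (-10 : ℤ) ∧ 2 * (-1) * 7 = (-14 : ℤ) ∧
    2 * 1 * 9 = (18 : ℤ) := by norm_num

end Summit.HodgeConjecture.HodgeConjecture.HodgeLocus.Census.Depth22
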